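import Literature.Geometry.Riemannian.PinchingFamily
import HarnessLib

/-!
# Pinching survives the surgical conformal change: the algebra of Hamilton's Thm. D3.1
(topic `Geometry/Riemannian`)

A brick of the surgery step of Chen–Zhu's Thm. 5.6
(`Literature.Geometry.Riemannian.chenZhu_surgicalStep_admissibleRestart`,
`HamiltonPICDecomposition.lean`). Chen–Zhu 2006, **Lemma 5.3** ("Justification of the pinching
assumption", = Hamilton 1997, **Thm. D3.1**): after a `δ`-cutoff surgery the new metric
`g̃ = e^{-2f} ḡ` still satisfies the pinching estimates. Hamilton's proof (Comm. Anal. Geom. 5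
(1997), §4.2–4.3, pp. 49–58) has a geometric half — on an `(ε, k)`-neck the conformal change by
`f = c e^{-p/(z-λ)}` changes the curvature blocks by `ãᵢ ≈ e^{2f}(aᵢ + 2D₄D₄f)`,
`c̃ᵢ ≈ e^{2f}(cᵢ + 2D₄D₄f)`, `b̃ᵢ ≈ e^{2f}(bᵢ - 2D₄D₄f)` up to errors `θ D₄D₄f` with `θ` as small
as we like (Thm. D2.6, Cor. D2.7), while `e^{2f} - 1` is small compared with `D₄D₄f` times the
curvature scale (Lemma D2.4: `e^{2f} - 1 ≤ δ d²f/dz²`) — and an algebraic half (§4.3, p. 57–58):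
**a change of the blocks of this shape keeps them inside the complete system of pinching
inequalities** ("Since the `aᵢ` and `cᵢ` increase while the `bᵢ` decrease, `a₁ + a₂ ≥ m`, …,
`a₁ + ρ > 0` … are all easy. The estimates `a₂ + a₃ ≤ Φ(a₁ + a₂)`, …, `a₃ ≤ Ψ(a₁ + ρ)` are
also easy if `Φ ≥ 2` and `Ψ ≥ 2`, since the `a₁, a₂, a₃` all increase about the same amount. For
the improved pinching estimates … the right hand sides increase if `a₁, a₂, c₁, c₂` increase …
since the function `y = x / ln x` … is increasing").

This file PROVES the algebraic half for Hamilton's family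
`HamiltonODE.pinchingFamily m Λ Φ ρ₁ ρ Ψ K L P Q t` (`PinchingFamily.lean`, the invariant of the
inductive construction, cf. `StagePinchingInvariant.lean`), in the variational language of
`PinchingEstimatesODE.lean` and in the following robust form. Let `p = (A, B, C)` lie in the
family at time `t ≥ 0` and let `q = (Ã, B̃, C̃)` have symmetric `Ã, C̃` with `tr Ã = tr C̃`
(the Bianchi constraint, automatic for curvature blocks). Suppose that for some scale factor
`s ≥ 1` (`= e^{2f}`), shift `τ > 0` (`= D₄D₄f`-term), contraction factor `λ ∈ [0, 1]`, bound
`N` for the quadratic forms of `B` and relative error `θ`: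
* `|wᵀÃw - s(wᵀAw + τ)| ≤ sθτ` and `|wᵀC̃w - s(wᵀCw + τ)| ≤ sθτ` for unit `w` — the quadratic
  forms of `A` and `C` are shifted up by `τ` (all eigenvalues "increase about the same amount"),
  then scaled;
* `|uᵀB̃v - sλ uᵀBv| ≤ sθτ` for unit `u, v` — the bilinear form of `B` is contracted, then
  scaled (the decrease of the `bᵢ` is not used quantitatively: `λ ≤ 1` suffices);
* `(s - 1)(N + ρ + τ) ≤ θτ` — the excess of the scale factor over `1` is small compared with the
  shift, relative to the curvature scale (Hamilton's `e^{2f} - 1 ≤ δ d²f/dz²` with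
  `aᵢ, bᵢ, cᵢ ≤ 2/r₀²`, p. 57);
then, **if `θ ≤ min{1/8, L/16}`, `q` lies in the family at the same time `t`**
(`HamiltonODE.mem_pinchingFamily_of_shift`), for constants `m > 0`, `Λ ≥ 1`, `Φ ≥ 2`,
`0 ≤ ρ₁ ≤ ρ`, `Ψ ≥ 2`, `K ≥ 0`, `L > 0`, `Q ≥ 2` and times with `Pt ≥ 0` (the constants of
`exists_pinchingFamily_of_hasPositiveIsotropicCurvature` in `StagePinchingInvariant.lean` have
`Λ = 4K₀²/m² + 1 ≥ 1`, `Φ ≥ Λ + 1 ≥ 2`, `Ψ = 4(Φ+1)² + 1 + K₀ ≥ 2`). A non-vacuity check is the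
exact shift `(A + τ·1, B, C + τ·1)`, `τ > 0` (`HamiltonODE.mem_pinchingFamily_add_smul_one`). Each of the twelve inequalities is checked as in the printed
proof; the two improved estimates use that Hamilton's right-hand sides
`F(u) = (1 + K/max{ln u, Q}) u` increase with slope at least `1`
(`HamiltonODE.le_logBarrier_sub`, from `monotoneOn_div_max_log` of
`PinchingSetsConcavity.lean`), so that the gain `≥ τ` on the right absorbs the errors `O(θτ)` on
the left.

Everything here is proved; no definitions, no named facts. The geometric half (the shape of the
change of the blocks under `g̃ = e^{-2f} ḡ` on a `δ`-neck, Thm. D2.6) is not in this file.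

## References

* R. S. Hamilton, *Four-manifolds with positive isotropic curvature*, Comm. Anal. Geom. 5 (1997)
  1–92: §4.2 (Lemma 2.4, Thm. 2.6, Cor. 2.7, pp. 53–57), §4.3 (Thm. 3.1 = D3.1 and its proof,
  pp. 57–58). [Hamilton1997]
* B.-L. Chen, X.-P. Zhu, *Ricci flow with surgery on four-manifolds with positive isotropic
  curvature*, J. Differential Geom. 74 (2006) 177–264 (arXiv:math/0504478), §5, Lemma 5.3
  (p. 29). [ChenZhu2006]
-/

noncomputable section

open Set Real
open scoped Matrix

namespace Literature.Geometry.Riemannian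

namespace HamiltonODE

/-! ### Two real-variable lemmas -/

/-- `√(xy) + d ≤ √((x + d)(y + d))` for `x, y, d ≥ 0` (AM–GM: `2√(xy) ≤ x + y`). [folklore] -/
theorem sqrt_mul_add_le_sqrt {x y d : ℝ} (hx : 0 ≤ x) (hy : 0 ≤ y) (hd : 0 ≤ d) :
    sqrt (x * y) + d ≤ sqrt ((x + d) * (y + d)) := by
  have hxy : 0 ≤ sqrt (x * y) := sqrt_nonneg _
  have h2 : 2 * sqrt (x * y) ≤ x + y := by
    rw [sqrt_mul hx]
    nlinarith [sq_nonneg (sqrt x - sqrt y), sq_sqrt hx, sq_sqrt hy, sqrt_nonneg x, sqrt_nonneg y]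
  have hsq : sqrt (x * y) ^ 2 = x * y := sq_sqrt (mul_nonneg hx hy)
  have key : (sqrt (x * y) + d) ^ 2 ≤ (x + d) * (y + d) := by nlinarith
  calc sqrt (x * y) + d = sqrt ((sqrt (x * y) + d) ^ 2) := (sqrt_sq (by positivity)).symm
    _ ≤ sqrt ((x + d) * (y + d)) := sqrt_le_sqrt key

/-- **Hamilton's right-hand side has slope at least one**: for `K ≥ 0`, `Q ≥ 2` and
`0 ≤ u ≤ u'`, `(1 + K/max{ln u', Q}) u' ≥ (1 + K/max{ln u, Q}) u + (u' - u)` — because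
`u ↦ u / max{ln u, Q}` is non-decreasing on `[0, ∞)` (`monotoneOn_div_max_log`; Hamilton 1997,
p. 58: "`y = x/ln x` has `y' = (ln x - 1)/ln² x > 0`"). [cite: Hamilton1997, §4.3, p. 58] -/
theorem le_logBarrier_sub {K Q u u' : ℝ} (hK : 0 ≤ K) (hQ : 2 ≤ Q) (hu : 0 ≤ u) (huu' : u ≤ u') :
    (1 + K / max (log u) Q) * u + (u' - u) ≤ (1 + K / max (log u') Q) * u' := by
  have hmono := monotoneOn_div_max_log hQ (mem_Ici.2 hu) (mem_Ici.2 (hu.trans huu')) huu'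
  simp only at hmono
  have e : ∀ v : ℝ, (1 + K / max (log v) Q) * v = v + K * (v / max (log v) Q) := fun v ↦ by ring
  rw [e, e]
  nlinarith

/-- `(b + d)² ≤ Λ (x + d')(y + d')` from `b² ≤ Λ x y`, for `0 ≤ b`, `0 < x, y`, `Λ ≥ 1`,
`0 ≤ d`, `2d ≤ d'` (the estimate `(b₂ + b₃)² ≤ Λ(a₁ + a₂)(c₁ + c₂)` survives an increase of
`a₁ + a₂`, `c₁ + c₂` by `d'` and an error `d` on `b₂ + b₃`). [folklore] -/
theorem sq_add_le_mul_add_mul_add {b d d' x y Λ : ℝ} (hb : 0 ≤ b) (hx : 0 < x) (hy : 0 < y)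
    (hΛ : 1 ≤ Λ) (hd : 0 ≤ d) (hdd' : 2 * d ≤ d') (h : b ^ 2 ≤ Λ * x * y) :
    (b + d) ^ 2 ≤ Λ * (x + d') * (y + d') := by
  -- `b ≤ √Λ √x √y` and `2 √x √y ≤ x + y`
  set l := sqrt Λ with hl
  set a := sqrt x with ha
  set c := sqrt y with hc
  have hl1 : 1 ≤ l := by rw [hl]; exact one_le_sqrt.mpr hΛ
  have hl2 : l ^ 2 = Λ := sq_sqrt (by linarith)
  have ha2 : a ^ 2 = x := sq_sqrt hx.le
  have hc2 : c ^ 2 = y := sq_sqrt hy.le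
  have ha0 : 0 ≤ a := sqrt_nonneg _
  have hc0 : 0 ≤ c := sqrt_nonneg _
  have hlac : 0 ≤ l * a * c := by positivity
  have hbl : b ≤ l * a * c := by
    have h' : b ^ 2 ≤ (l * a * c) ^ 2 := by
      calc b ^ 2 ≤ Λ * x * y := h
        _ = (l * a * c) ^ 2 := by rw [← hl2, ← ha2, ← hc2]; ring
    exact (pow_le_pow_iff_left₀ hb hlac two_ne_zero).1 h'
  -- compare term by term
  have h1 : 2 * (l * a * c) * d ≤ l ^ 2 * d' * (a ^ 2 + c ^ 2) := by
    have hac : 2 * (a * c) ≤ a ^ 2 + c ^ 2 := by nlinarith [sq_nonneg (a - c)]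
    have hl2l : l ≤ l ^ 2 := by nlinarith
    have hacd : 0 ≤ a * c * d := by positivity
    calc 2 * (l * a * c) * d = l * d * (2 * (a * c)) := by ring
      _ ≤ l * d * (a ^ 2 + c ^ 2) := mul_le_mul_of_nonneg_left hac (by positivity)
      _ ≤ l ^ 2 * d' * (a ^ 2 + c ^ 2) := by
          have : l * d ≤ l ^ 2 * d' := by nlinarith [mul_le_mul hl2l (by linarith : d ≤ d') hd (by positivity)]
          exact mul_le_mul_of_nonneg_right this (by positivity)
  have h2 : d ^ 2 ≤ l ^ 2 * d' ^ 2 := by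
    have hdd : d ≤ d' := by linarith
    have : d ^ 2 ≤ d' ^ 2 := pow_le_pow_left₀ hd hdd 2
    nlinarith [pow_le_pow_left₀ zero_le_one hl1 2]
  have hd'0 : 0 ≤ d' := by linarith
  calc (b + d) ^ 2 = b ^ 2 + 2 * b * d + d ^ 2 := by ring
    _ ≤ (l * a * c) ^ 2 + 2 * (l * a * c) * d + d ^ 2 := by
        gcongr
    _ ≤ (l * a * c) ^ 2 + l ^ 2 * d' * (a ^ 2 + c ^ 2) + l ^ 2 * d' ^ 2 := by linarith
    _ ≤ Λ * (x + d') * (y + d') := by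
        rw [← hl2, ← ha2, ← hc2]
        nlinarith [mul_nonneg (mul_nonneg (sq_nonneg l) hd'0) (sq_nonneg a),
          mul_nonneg (mul_nonneg (sq_nonneg l) hd'0) (sq_nonneg c)]

/-! ### The standing hypotheses on the change of the blocks -/

namespace Shift

variable {m Λ Φ ρ₁ ρ Ψ K L P Q t : ℝ} {p q : Blocks} {s τ κ θ N : ℝ}
  (hs : 1 ≤ s) (hτ : 0 < τ) (hκ0 : 0 ≤ κ) (hκ1 : κ ≤ 1) (hθ0 : 0 ≤ θ) (hθ8 : θ ≤ 1 / 8)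
  (hρ₁ : 0 ≤ ρ₁) (hρ : ρ₁ ≤ ρ)
  (hN : ∀ u v : Fin 3 → ℝ, u ⬝ᵥ u = 1 → v ⬝ᵥ v = 1 → |u ⬝ᵥ (p.2.1 *ᵥ v)| ≤ N)
  (hsN : (s - 1) * (N + ρ + τ) ≤ θ * τ)
  (hA : ∀ w : Fin 3 → ℝ, w ⬝ᵥ w = 1 →
    |w ⬝ᵥ (q.1 *ᵥ w) - s * (w ⬝ᵥ (p.1 *ᵥ w) + τ)| ≤ s * θ * τ)
  (hB : ∀ u v : Fin 3 → ℝ, u ⬝ᵥ u = 1 → v ⬝ᵥ v = 1 →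
    |u ⬝ᵥ (q.2.1 *ᵥ v) - s * κ * (u ⬝ᵥ (p.2.1 *ᵥ v))| ≤ s * θ * τ)
  (hC : ∀ w : Fin 3 → ℝ, w ⬝ᵥ w = 1 →
    |w ⬝ᵥ (q.2.2 *ᵥ w) - s * (w ⬝ᵥ (p.2.2 *ᵥ w) + τ)| ≤ s * θ * τ)

/-- A unit vector of `ℝ³`. [folklore] -/
theorem unit_e0 : ((![1, 0, 0] : Fin 3 → ℝ) ⬝ᵥ ![1, 0, 0]) = 1 := by
  simp [dotProduct, Fin.sum_univ_three]

include hs hτ hρ₁ hρ hN hsN in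
/-- `(s - 1) N ≤ θτ`, `(s - 1) ρ ≤ θτ`, `(s - 1) τ ≤ θτ` and `s ≤ 1 + θ`. [folklore] -/
theorem scale_bounds :
    (s - 1) * N ≤ θ * τ ∧ (s - 1) * ρ ≤ θ * τ ∧ (s - 1) * τ ≤ θ * τ ∧ s ≤ 1 + θ := by
  have hN0 : 0 ≤ N := (abs_nonneg _).trans (hN _ _ unit_e0 unit_e0)
  have hs0 : 0 ≤ s - 1 := by linarith
  have hρ0 : 0 ≤ ρ := hρ₁.trans hρ
  have h1 : (s - 1) * N ≤ θ * τ := by nlinarith [mul_nonneg hs0 hρ0, mul_nonneg hs0 hτ.le]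
  have h2 : (s - 1) * ρ ≤ θ * τ := by nlinarith [mul_nonneg hs0 hN0, mul_nonneg hs0 hτ.le]
  have h3 : (s - 1) * τ ≤ θ * τ := by nlinarith [mul_nonneg hs0 hN0, mul_nonneg hs0 hρ0]
  exact ⟨h1, h2, h3, by nlinarith⟩

include hA in
/-- Lower bound for the quadratic form of `Ã`. [folklore] -/
theorem quadA_ge {w : Fin 3 → ℝ} (hw : w ⬝ᵥ w = 1) :
    s * (w ⬝ᵥ (p.1 *ᵥ w) + τ) - s * θ * τ ≤ w ⬝ᵥ (q.1 *ᵥ w) := by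
  have := (abs_le.1 (hA w hw)).1; linarith

include hA in
/-- Upper bound for the quadratic form of `Ã`. [folklore] -/
theorem quadA_le {w : Fin 3 → ℝ} (hw : w ⬝ᵥ w = 1) :
    w ⬝ᵥ (q.1 *ᵥ w) ≤ s * (w ⬝ᵥ (p.1 *ᵥ w) + τ) + s * θ * τ := by
  have := (abs_le.1 (hA w hw)).2; linarith

include hC in
/-- Lower bound for the quadratic form of `C̃`. [folklore] -/
theorem quadC_ge {w : Fin 3 → ℝ} (hw : w ⬝ᵥ w = 1) :
    s * (w ⬝ᵥ (p.2.2 *ᵥ w) + τ) - s * θ * τ ≤ w ⬝ᵥ (q.2.2 *ᵥ w) := by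
  have := (abs_le.1 (hC w hw)).1; linarith

include hC in
/-- Upper bound for the quadratic form of `C̃`. [folklore] -/
theorem quadC_le {w : Fin 3 → ℝ} (hw : w ⬝ᵥ w = 1) :
    w ⬝ᵥ (q.2.2 *ᵥ w) ≤ s * (w ⬝ᵥ (p.2.2 *ᵥ w) + τ) + s * θ * τ := by
  have := (abs_le.1 (hC w hw)).2; linarith

include hs hτ hκ0 hκ1 hθ0 hθ8 hρ₁ hρ hN hsN hB in
/-- **The bilinear form of `B̃` exceeds `max{uᵀBv, 0}` by at most `3θτ`**:
`uᵀB̃v ≤ sκ uᵀBv + sθτ ≤ max{uᵀBv, 0} + (s-1)N + sθτ`. [cite: Hamilton1997, §4.3, p. 57] -/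
theorem quadB_le {u v : Fin 3 → ℝ} (hu : u ⬝ᵥ u = 1) (hv : v ⬝ᵥ v = 1) :
    u ⬝ᵥ (q.2.1 *ᵥ v) ≤ max (u ⬝ᵥ (p.2.1 *ᵥ v)) 0 + 3 * θ * τ := by
  obtain ⟨h1, -, h3, h4⟩ := scale_bounds hs hτ hρ₁ hρ hN hsN
  have hb := (abs_le.1 (hB u v hu hv)).2
  have hbN := (abs_le.1 (hN u v hu hv)).2
  set b := u ⬝ᵥ (p.2.1 *ᵥ v) with hbdef
  have hmax0 : 0 ≤ max b 0 := le_max_right _ _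
  have hbmax : b ≤ max b 0 := le_max_left _ _
  -- `sκ b ≤ s max{b,0} = max{b,0} + (s-1) max{b,0} ≤ max{b,0} + (s-1) N`
  have hk : s * κ * b ≤ s * max b 0 := by
    have : κ * b ≤ max b 0 := by
      rcases le_or_gt 0 b with hb0 | hb0
      · rw [max_eq_left hb0]; nlinarith
      · rw [max_eq_right hb0.le]; nlinarith
    nlinarith
  have hmaxN : max b 0 ≤ N := max_le hbN ((abs_nonneg _).trans (hN _ _ unit_e0 unit_e0))
  have hs0 : 0 ≤ s - 1 := by linarith
  -- `(s-1) max{b,0} ≤ (s-1) N ≤ θτ` and `sθτ ≤ (1+θ)θτ ≤ 2θτ`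
  have e1 : (s - 1) * max b 0 ≤ θ * τ := (mul_le_mul_of_nonneg_left hmaxN hs0).trans h1
  have e2 : s * θ * τ ≤ 2 * (θ * τ) := by
    have hθτ : 0 ≤ θ * τ := mul_nonneg hθ0 hτ.le
    nlinarith
  calc u ⬝ᵥ (q.2.1 *ᵥ v) ≤ s * κ * b + s * θ * τ := by linarith
    _ ≤ s * max b 0 + s * θ * τ := by linarith
    _ = max b 0 + (s - 1) * max b 0 + s * θ * τ := by ring
    _ ≤ max b 0 + 3 * θ * τ := by linarith

/-! ### The twelve inequalities, one by one (Hamilton 1997, §4.3, pp. 57–58) -/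

include hs hτ hθ8 hA in
/-- **`a₁ + a₂ ≥ m` survives** ("easy": the `aᵢ` increase). [cite: Hamilton1997, §4.3, p. 57] -/
theorem twoSmallest_fst (hm : 0 < m) (h : p.1.TwoSmallestEigenvaluesSumGE m) :
    q.1.TwoSmallestEigenvaluesSumGE m := by
  intro u v hu hv huv
  have hp := h u v hu hv huv
  have hu' := quadA_ge hA hu
  have hv' := quadA_ge hA hv
  have hX0 : 0 ≤ u ⬝ᵥ (p.1 *ᵥ u) + v ⬝ᵥ (p.1 *ᵥ v) := hm.le.trans hp
  have hs0 : 0 ≤ s - 1 := by linarith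
  nlinarith [mul_nonneg hs0 hX0, mul_nonneg (by linarith : (0:ℝ) ≤ s) (mul_nonneg (by linarith : (0:ℝ) ≤ 1 - θ) hτ.le)]

include hs hτ hθ8 hC in
/-- **`c₁ + c₂ ≥ m` survives.** [cite: Hamilton1997, §4.3, p. 57] -/
theorem twoSmallest_snd (hm : 0 < m) (h : p.2.2.TwoSmallestEigenvaluesSumGE m) :
    q.2.2.TwoSmallestEigenvaluesSumGE m := by
  intro u v hu hv huv
  have hp := h u v hu hv huv
  have hu' := quadC_ge hC hu
  have hv' := quadC_ge hC hv
  have hX0 : 0 ≤ u ⬝ᵥ (p.2.2 *ᵥ u) + v ⬝ᵥ (p.2.2 *ᵥ v) := hm.le.trans hp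
  have hs0 : 0 ≤ s - 1 := by linarith
  nlinarith [mul_nonneg hs0 hX0, mul_nonneg (by linarith : (0:ℝ) ≤ s) (mul_nonneg (by linarith : (0:ℝ) ≤ 1 - θ) hτ.le)]

include hs hτ hθ8 hA in
/-- **`a₂ + a₃ ≤ Φ (a₁ + a₂)` survives for `Φ ≥ 2`** ("the `a₁, a₂, a₃` all increase about the
same amount"). [cite: Hamilton1997, §4.3, p. 57] -/
theorem twoLargest_fst (hΦ : 2 ≤ Φ) (h : p.1.TwoLargestEigenvaluesSumLE Φ) :
    q.1.TwoLargestEigenvaluesSumLE Φ := by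
  intro u v w w' hu hv huv hw hw' hww
  have hp := h u v w w' hu hv huv hw hw' hww
  have hu' := quadA_le hA hu
  have hv' := quadA_le hA hv
  have hw1 := quadA_ge hA hw
  have hw2 := quadA_ge hA hw'
  have hs0 : 0 ≤ s := by linarith
  -- `s (X_u + X_v) ≤ s Φ (X_w + X_w')` and `2sτ(1+θ) ≤ 2Φsτ(1-θ)`
  have e1 : s * (u ⬝ᵥ (p.1 *ᵥ u) + v ⬝ᵥ (p.1 *ᵥ v)) ≤
      s * (Φ * (w ⬝ᵥ (p.1 *ᵥ w) + w' ⬝ᵥ (p.1 *ᵥ w'))) := mul_le_mul_of_nonneg_left hp hs0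
  have e2 : 2 * (s * τ) * (1 + θ) ≤ 2 * (s * τ) * (Φ * (1 - θ)) := by
    have : 1 + θ ≤ Φ * (1 - θ) := by nlinarith
    exact mul_le_mul_of_nonneg_left this (by positivity)
  nlinarith

include hs hτ hθ8 hC in
/-- **`c₂ + c₃ ≤ Φ (c₁ + c₂)` survives for `Φ ≥ 2`.** [cite: Hamilton1997, §4.3, p. 57] -/
theorem twoLargest_snd (hΦ : 2 ≤ Φ) (h : p.2.2.TwoLargestEigenvaluesSumLE Φ) :
    q.2.2.TwoLargestEigenvaluesSumLE Φ := by
  intro u v w w' hu hv huv hw hw' hww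
  have hp := h u v w w' hu hv huv hw hw' hww
  have hu' := quadC_le hC hu
  have hv' := quadC_le hC hv
  have hw1 := quadC_ge hC hw
  have hw2 := quadC_ge hC hw'
  have hs0 : 0 ≤ s := by linarith
  have e1 : s * (u ⬝ᵥ (p.2.2 *ᵥ u) + v ⬝ᵥ (p.2.2 *ᵥ v)) ≤
      s * (Φ * (w ⬝ᵥ (p.2.2 *ᵥ w) + w' ⬝ᵥ (p.2.2 *ᵥ w'))) := mul_le_mul_of_nonneg_left hp hs0
  have e2 : 2 * (s * τ) * (1 + θ) ≤ 2 * (s * τ) * (Φ * (1 - θ)) := by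
    have : 1 + θ ≤ Φ * (1 - θ) := by nlinarith
    exact mul_le_mul_of_nonneg_left this (by positivity)
  nlinarith

include hs hτ hθ8 hρ₁ hρ hN hsN hA in
/-- **`a₁ + ρ₁ ≥ 0` survives** ("easy"; uses `(s-1)ρ₁ ≤ θτ`: the scaling cannot push a
slightly negative `a₁` below `-ρ₁` by more than the shift lifts it).
[cite: Hamilton1997, §4.3, p. 57] -/
theorem smallestAddNonneg_fst (h : p.1.SmallestEigenvalueAddNonneg ρ₁) :
    q.1.SmallestEigenvalueAddNonneg ρ₁ := by
  intro w hw
  have hp := h w hw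
  have hw' := quadA_ge hA hw
  obtain ⟨-, h2, -, -⟩ := scale_bounds hs hτ hρ₁ hρ hN hsN
  have hs0 : 0 ≤ s - 1 := by linarith
  -- `s X_w = X_w + (s-1) X_w ≥ X_w - (s-1)ρ₁ ≥ X_w - θτ`
  have e1 : -(θ * τ) ≤ (s - 1) * (w ⬝ᵥ (p.1 *ᵥ w)) := by
    have : (s - 1) * (-ρ₁) ≤ (s - 1) * (w ⬝ᵥ (p.1 *ᵥ w)) :=
      mul_le_mul_of_nonneg_left (by linarith) hs0
    nlinarith [mul_le_mul_of_nonneg_left hρ hs0]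
  have e2 : 0 ≤ (s - 1) * (τ * (1 - θ)) := mul_nonneg hs0 (mul_nonneg hτ.le (by linarith))
  have e3 : θ * τ ≤ τ / 8 := by nlinarith
  linarith

include hs hτ hθ8 hρ₁ hρ hN hsN hC in
/-- **`c₁ + ρ₁ ≥ 0` survives.** [cite: Hamilton1997, §4.3, p. 57] -/
theorem smallestAddNonneg_snd (h : p.2.2.SmallestEigenvalueAddNonneg ρ₁) :
    q.2.2.SmallestEigenvalueAddNonneg ρ₁ := by
  intro w hw
  have hp := h w hw
  have hw' := quadC_ge hC hw
  obtain ⟨-, h2, -, -⟩ := scale_bounds hs hτ hρ₁ hρ hN hsN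
  have hs0 : 0 ≤ s - 1 := by linarith
  have e1 : -(θ * τ) ≤ (s - 1) * (w ⬝ᵥ (p.2.2 *ᵥ w)) := by
    have : (s - 1) * (-ρ₁) ≤ (s - 1) * (w ⬝ᵥ (p.2.2 *ᵥ w)) :=
      mul_le_mul_of_nonneg_left (by linarith) hs0
    nlinarith [mul_le_mul_of_nonneg_left hρ hs0]
  have e2 : 0 ≤ (s - 1) * (τ * (1 - θ)) := mul_nonneg hs0 (mul_nonneg hτ.le (by linarith))
  have e3 : θ * τ ≤ τ / 8 := by nlinarith
  linarith

include hs hτ hθ0 hθ8 hρ₁ hρ hN hsN hA in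
/-- **`a₃ ≤ Ψ (a₁ + ρ)` survives for `Ψ ≥ 2`** ("easy if `Ψ ≥ 2`, since the `a₁, a₂, a₃` all
increase about the same amount"; the constant `ρ` is not scaled, which costs `(s-1)ρ ≤ θτ`).
[cite: Hamilton1997, §4.3, p. 57] -/
theorem largestLESmallestAdd_fst (hΨ : 2 ≤ Ψ) (h : p.1.LargestLESmallestAdd Ψ ρ) :
    q.1.LargestLESmallestAdd Ψ ρ := by
  intro u w hu hw
  have hp := h u w hu hw
  have hu' := quadA_le hA hu
  have hw' := quadA_ge hA hw
  obtain ⟨-, h2, -, h4⟩ := scale_bounds hs hτ hρ₁ hρ hN hsN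
  have hs0 : 0 ≤ s := by linarith
  have hΨ0 : 0 ≤ Ψ := by linarith
  -- `s X_u ≤ s Ψ (X_w + ρ)`
  have e1 : s * (u ⬝ᵥ (p.1 *ᵥ u)) ≤ s * (Ψ * (w ⬝ᵥ (p.1 *ᵥ w) + ρ)) :=
    mul_le_mul_of_nonneg_left hp hs0
  -- the key numerical inequality `Ψ(s-1)ρ + sτ(1+θ) ≤ Ψ s τ (1-θ)`
  have e2 : Ψ * ((s - 1) * ρ) ≤ Ψ * (θ * τ) := mul_le_mul_of_nonneg_left h2 hΨ0
  have e3 : Ψ * (θ * τ) + s * τ * (1 + θ) ≤ Ψ * (s * τ) * (1 - θ) := by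
    have hsτ : 0 ≤ s * τ := mul_nonneg hs0 hτ.le
    have k1 : Ψ * (θ * τ) ≤ Ψ * (θ * (s * τ)) := by
      apply mul_le_mul_of_nonneg_left _ hΨ0
      nlinarith [mul_nonneg hθ0 hτ.le]
    have k2 : 1 + θ + Ψ * θ ≤ Ψ * (1 - θ) := by nlinarith
    nlinarith [mul_le_mul_of_nonneg_left k2 hsτ]
  nlinarith

include hs hτ hθ0 hθ8 hρ₁ hρ hN hsN hC in
/-- **`c₃ ≤ Ψ (c₁ + ρ)` survives for `Ψ ≥ 2`.** [cite: Hamilton1997, §4.3, p. 57] -/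
theorem largestLESmallestAdd_snd (hΨ : 2 ≤ Ψ) (h : p.2.2.LargestLESmallestAdd Ψ ρ) :
    q.2.2.LargestLESmallestAdd Ψ ρ := by
  intro u w hu hw
  have hp := h u w hu hw
  have hu' := quadC_le hC hu
  have hw' := quadC_ge hC hw
  obtain ⟨-, h2, -, h4⟩ := scale_bounds hs hτ hρ₁ hρ hN hsN
  have hs0 : 0 ≤ s := by linarith
  have hΨ0 : 0 ≤ Ψ := by linarith
  have e1 : s * (u ⬝ᵥ (p.2.2 *ᵥ u)) ≤ s * (Ψ * (w ⬝ᵥ (p.2.2 *ᵥ w) + ρ)) :=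
    mul_le_mul_of_nonneg_left hp hs0
  have e2 : Ψ * ((s - 1) * ρ) ≤ Ψ * (θ * τ) := mul_le_mul_of_nonneg_left h2 hΨ0
  have e3 : Ψ * (θ * τ) + s * τ * (1 + θ) ≤ Ψ * (s * τ) * (1 - θ) := by
    have hsτ : 0 ≤ s * τ := mul_nonneg hs0 hτ.le
    have k1 : Ψ * (θ * τ) ≤ Ψ * (θ * (s * τ)) := by
      apply mul_le_mul_of_nonneg_left _ hΨ0
      nlinarith [mul_nonneg hθ0 hτ.le]
    have k2 : 1 + θ + Ψ * θ ≤ Ψ * (1 - θ) := by nlinarith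
    nlinarith [mul_le_mul_of_nonneg_left k2 hsτ]
  nlinarith

include hs hτ hθ8 hρ₁ hρ hN hsN hA in
/-- **The right-hand sides gain at least `τ(1 - 2θ)`**: `wᵀÃw + ρ ≥ wᵀAw + ρ + τ(1 - 2θ)` for
unit `w` (the shift `τ`, minus the error `θτ`, minus the scaling loss `(s-1)ρ ≤ θτ` on the
unscaled constant `ρ`; uses `wᵀAw ≥ -ρ₁ ≥ -ρ`). [cite: Hamilton1997, §4.3, p. 57] -/
theorem quadA_add_ge (h6 : p.1.SmallestEigenvalueAddNonneg ρ₁) {w : Fin 3 → ℝ}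
    (hw : w ⬝ᵥ w = 1) :
    w ⬝ᵥ (p.1 *ᵥ w) + ρ + τ * (1 - 2 * θ) ≤ w ⬝ᵥ (q.1 *ᵥ w) + ρ := by
  have hw' := quadA_ge hA hw
  have hp := h6 w hw
  obtain ⟨-, h2, -, -⟩ := scale_bounds hs hτ hρ₁ hρ hN hsN
  have hs0 : 0 ≤ s - 1 := by linarith
  have e1 : (s - 1) * (-ρ) ≤ (s - 1) * (w ⬝ᵥ (p.1 *ᵥ w) + τ * (1 - θ)) :=
    mul_le_mul_of_nonneg_left (by nlinarith [hτ.le]) hs0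
  nlinarith

include hs hτ hθ8 hρ₁ hρ hN hsN hC in
/-- The same gain for `C̃`. [cite: Hamilton1997, §4.3, p. 57] -/
theorem quadC_add_ge (h7 : p.2.2.SmallestEigenvalueAddNonneg ρ₁) {w : Fin 3 → ℝ}
    (hw : w ⬝ᵥ w = 1) :
    w ⬝ᵥ (p.2.2 *ᵥ w) + ρ + τ * (1 - 2 * θ) ≤ w ⬝ᵥ (q.2.2 *ᵥ w) + ρ := by
  have hw' := quadC_ge hC hw
  have hp := h7 w hw
  obtain ⟨-, h2, -, -⟩ := scale_bounds hs hτ hρ₁ hρ hN hsN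
  have hs0 : 0 ≤ s - 1 := by linarith
  have e1 : (s - 1) * (-ρ) ≤ (s - 1) * (w ⬝ᵥ (p.2.2 *ᵥ w) + τ * (1 - θ)) :=
    mul_le_mul_of_nonneg_left (by nlinarith [hτ.le]) hs0
  nlinarith

include hA in
/-- **The pair sums gain at least `2τ(1-θ)`, then scale**:
`wᵀÃw + w'ᵀÃw' ≥ s (wᵀAw + w'ᵀAw' + 2τ(1-θ))`. [cite: Hamilton1997, §4.3, p. 57] -/
theorem pairA_ge {w w' : Fin 3 → ℝ} (hw : w ⬝ᵥ w = 1) (hw' : w' ⬝ᵥ w' = 1) :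
    s * (w ⬝ᵥ (p.1 *ᵥ w) + w' ⬝ᵥ (p.1 *ᵥ w') + 2 * τ * (1 - θ)) ≤
      w ⬝ᵥ (q.1 *ᵥ w) + w' ⬝ᵥ (q.1 *ᵥ w') := by
  have h1 := quadA_ge hA hw
  have h2 := quadA_ge hA hw'
  nlinarith

include hC in
/-- The same for `C̃`. [cite: Hamilton1997, §4.3, p. 57] -/
theorem pairC_ge {z z' : Fin 3 → ℝ} (hz : z ⬝ᵥ z = 1) (hz' : z' ⬝ᵥ z' = 1) :
    s * (z ⬝ᵥ (p.2.2 *ᵥ z) + z' ⬝ᵥ (p.2.2 *ᵥ z') + 2 * τ * (1 - θ)) ≤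
      z ⬝ᵥ (q.2.2 *ᵥ z) + z' ⬝ᵥ (q.2.2 *ᵥ z') := by
  have h1 := quadC_ge hC hz
  have h2 := quadC_ge hC hz'
  nlinarith

include hs hτ hκ0 hκ1 hθ0 hθ8 hA hB hC in
/-- **`(b₂ + b₃)² ≤ Λ (a₁ + a₂)(c₁ + c₂)` survives for `Λ ≥ 1`** ("easy": the left-hand side
changes by `O(θτ)`, the right-hand side gains `2Λτ(a₁ + a₂ + c₁ + c₂)`;
`sq_add_le_mul_add_mul_add`). [cite: Hamilton1997, §4.3, p. 57] -/
theorem singularValuesSumSqLE (hm : 0 < m) (hΛ : 1 ≤ Λ)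
    (h1 : p.1.TwoSmallestEigenvaluesSumGE m) (h2 : p.2.2.TwoSmallestEigenvaluesSumGE m)
    (h : SingularValuesSumSqLE p Λ) : SingularValuesSumSqLE q Λ := by
  intro u₁ u₂ v₁ v₂ w w' z z' hu₁ hu₂ hu₁₂ hv₁ hv₂ hv₁₂ hw hw' hww hz hz' hzz
  have hp := h u₁ u₂ v₁ v₂ w w' z z' hu₁ hu₂ hu₁₂ hv₁ hv₂ hv₁₂ hw hw' hww hz hz' hzz
  set βp := u₁ ⬝ᵥ (p.2.1 *ᵥ v₁) + u₂ ⬝ᵥ (p.2.1 *ᵥ v₂) with hβp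
  set X := w ⬝ᵥ (p.1 *ᵥ w) + w' ⬝ᵥ (p.1 *ᵥ w') with hXdef
  set Y := z ⬝ᵥ (p.2.2 *ᵥ z) + z' ⬝ᵥ (p.2.2 *ᵥ z') with hYdef
  have hX : m ≤ X := h1 w w' hw hw' hww
  have hY : m ≤ Y := h2 z z' hz hz' hzz
  have hXpos : 0 < X := hm.trans_le hX
  have hYpos : 0 < Y := hm.trans_le hY
  have hs0 : 0 ≤ s := by linarith
  have hθτ : 0 ≤ θ * τ := mul_nonneg hθ0 hτ.le
  -- the two sides for `q`
  have hXq := pairA_ge hA hw hw'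
  have hYq := pairC_ge hC hz hz'
  have b1 := hB u₁ v₁ hu₁ hv₁
  have b2 := hB u₂ v₂ hu₂ hv₂
  set βq := u₁ ⬝ᵥ (q.2.1 *ᵥ v₁) + u₂ ⬝ᵥ (q.2.1 *ᵥ v₂) with hβq
  -- `|βq| ≤ s (|βp| + 2θτ)`
  have hdiff : |βq - s * κ * βp| ≤ 2 * (s * θ * τ) := by
    have e : βq - s * κ * βp = (u₁ ⬝ᵥ (q.2.1 *ᵥ v₁) - s * κ * (u₁ ⬝ᵥ (p.2.1 *ᵥ v₁))) +
        (u₂ ⬝ᵥ (q.2.1 *ᵥ v₂) - s * κ * (u₂ ⬝ᵥ (p.2.1 *ᵥ v₂))) := by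
      rw [hβq, hβp]; ring
    rw [e]
    exact (abs_add_le _ _).trans (by linarith)
  have hβq_le : |βq| ≤ s * (|βp| + 2 * (θ * τ)) := by
    have e : βq = s * κ * βp + (βq - s * κ * βp) := by ring
    have hk : |s * κ * βp| ≤ s * |βp| := by
      rw [abs_mul, abs_of_nonneg (mul_nonneg hs0 hκ0)]
      nlinarith [abs_nonneg βp, mul_le_mul_of_nonneg_left hκ1 hs0]
    calc |βq| = |s * κ * βp + (βq - s * κ * βp)| := by rw [← e]
      _ ≤ |s * κ * βp| + |βq - s * κ * βp| := abs_add_le _ _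
      _ ≤ s * |βp| + 2 * (s * θ * τ) := add_le_add hk hdiff
      _ = s * (|βp| + 2 * (θ * τ)) := by ring
  -- the real-variable lemma
  have hθτ8 : θ * τ ≤ 1 / 8 * τ := mul_le_mul_of_nonneg_right hθ8 hτ.le
  have hdd : 2 * (2 * (θ * τ)) ≤ 2 * τ * (1 - θ) := by linarith
  have hp' : |βp| ^ 2 ≤ Λ * X * Y := by rw [sq_abs]; exact hp
  have key : (|βp| + 2 * (θ * τ)) ^ 2 ≤ Λ * (X + 2 * τ * (1 - θ)) * (Y + 2 * τ * (1 - θ)) :=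
    sq_add_le_mul_add_mul_add (abs_nonneg _) hXpos hYpos hΛ (by positivity) hdd hp'
  have hd0 : 0 ≤ 2 * τ * (1 - θ) := by linarith
  have hXd : 0 ≤ X + 2 * τ * (1 - θ) := add_nonneg hXpos.le hd0
  have hYd : 0 ≤ Y + 2 * τ * (1 - θ) := add_nonneg hYpos.le hd0
  have hΛ0 : 0 ≤ Λ := by linarith
  calc βq ^ 2 = |βq| ^ 2 := (sq_abs _).symm
    _ ≤ (s * (|βp| + 2 * (θ * τ))) ^ 2 :=
        pow_le_pow_left₀ (abs_nonneg _) hβq_le 2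
    _ = s ^ 2 * (|βp| + 2 * (θ * τ)) ^ 2 := by ring
    _ ≤ s ^ 2 * (Λ * (X + 2 * τ * (1 - θ)) * (Y + 2 * τ * (1 - θ))) :=
        mul_le_mul_of_nonneg_left key (sq_nonneg _)
    _ = Λ * (s * (X + 2 * τ * (1 - θ))) * (s * (Y + 2 * τ * (1 - θ))) := by ring
    _ ≤ Λ * (w ⬝ᵥ (q.1 *ᵥ w) + w' ⬝ᵥ (q.1 *ᵥ w')) * (z ⬝ᵥ (q.2.2 *ᵥ z) + z' ⬝ᵥ (q.2.2 *ᵥ z')) := by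
        apply mul_le_mul (mul_le_mul_of_nonneg_left hXq hΛ0) hYq (mul_nonneg hs0 hYd)
        exact mul_nonneg hΛ0 ((mul_nonneg hs0 hXd).trans hXq)

include hs hτ hκ0 hκ1 hθ0 hθ8 hρ₁ hρ hN hsN hA hB hC in
/-- **`b₃ ≤ (L/2) e^{Pt} √((a₁ + ρ)(c₁ + ρ))` survives** (at `Pt ≥ 0`, with `θ ≤ L/16`): the
left-hand side changes by at most `3θτ`, the right-hand side gains at least
`(L/2) τ (1 - 2θ)`. [cite: Hamilton1997, §4.3, p. 57] -/
theorem singularValueLEExp (hL : 0 < L) (hθL : θ ≤ L / 16) (hPt : 0 ≤ P * t)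
    (h6 : p.1.SmallestEigenvalueAddNonneg ρ₁) (h7 : p.2.2.SmallestEigenvalueAddNonneg ρ₁)
    (h : SingularValueLEExp p (L / 2) P ρ t) : SingularValueLEExp q (L / 2) P ρ t := by
  intro u v w z hu hv hw hz
  have hp := h u v w z hu hv hw hz
  set b := u ⬝ᵥ (p.2.1 *ᵥ v) with hbdef
  set Xw := w ⬝ᵥ (p.1 *ᵥ w) with hXw
  set Yz := z ⬝ᵥ (p.2.2 *ᵥ z) with hYz
  set H := L / 2 * exp (P * t) with hH
  have hXρ : 0 ≤ Xw + ρ := by linarith [h6 w hw]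
  have hYρ : 0 ≤ Yz + ρ := by linarith [h7 z hz]
  have hexp : 1 ≤ exp (P * t) := one_le_exp hPt
  have hHL : L / 2 ≤ H := le_mul_of_one_le_right (by linarith) hexp
  have hH0 : 0 ≤ H := by linarith
  set r := sqrt ((Xw + ρ) * (Yz + ρ)) with hr
  have hr0 : 0 ≤ r := sqrt_nonneg _
  have hθτ8 : θ * τ ≤ 1 / 8 * τ := mul_le_mul_of_nonneg_right hθ8 hτ.le
  have hd0 : 0 ≤ τ * (1 - 2 * θ) := by linarith [hτ.le]
  -- the right-hand side gains `H τ (1 - 2θ)`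
  have hA' := quadA_add_ge hs hτ hθ8 hρ₁ hρ hN hsN hA h6 hw
  have hC' := quadC_add_ge hs hτ hθ8 hρ₁ hρ hN hsN hC h7 hz
  have hsq : r + τ * (1 - 2 * θ) ≤ sqrt ((w ⬝ᵥ (q.1 *ᵥ w) + ρ) * (z ⬝ᵥ (q.2.2 *ᵥ z) + ρ)) :=
    (sqrt_mul_add_le_sqrt hXρ hYρ hd0).trans
      (sqrt_le_sqrt (mul_le_mul hA' hC' (by linarith) (hXρ.trans (by linarith))))
  -- the left-hand side loses at most `3θτ`
  have hl := quadB_le hs hτ hκ0 hκ1 hθ0 hθ8 hρ₁ hρ hN hsN hB hu hv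
  have hmax : max b 0 ≤ H * r := max_le hp (mul_nonneg hH0 hr0)
  have hnum : 3 * θ * τ ≤ H * (τ * (1 - 2 * θ)) := by
    have ha : 3 * θ * τ ≤ 3 * (L / 16) * τ :=
      mul_le_mul_of_nonneg_right (by linarith) hτ.le
    have hb : L / 2 * (τ * (3 / 4)) ≤ L / 2 * (τ * (1 - 2 * θ)) :=
      mul_le_mul_of_nonneg_left (mul_le_mul_of_nonneg_left (by linarith) hτ.le) (by linarith)
    have hc : L / 2 * (τ * (1 - 2 * θ)) ≤ H * (τ * (1 - 2 * θ)) :=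
      mul_le_mul_of_nonneg_right hHL hd0
    have hLτ : 0 ≤ L * τ := mul_nonneg hL.le hτ.le
    linarith
  calc u ⬝ᵥ (q.2.1 *ᵥ v) ≤ max b 0 + 3 * θ * τ := hl
    _ ≤ H * r + H * (τ * (1 - 2 * θ)) := add_le_add hmax hnum
    _ = H * (r + τ * (1 - 2 * θ)) := by ring
    _ ≤ H * sqrt ((w ⬝ᵥ (q.1 *ᵥ w) + ρ) * (z ⬝ᵥ (q.2.2 *ᵥ z) + ρ)) :=
        mul_le_mul_of_nonneg_left hsq hH0

include hs hτ hκ0 hκ1 hθ0 hθ8 hρ₁ hρ hN hsN hA hB hC in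
/-- **The improved estimate `2b₃ ≤ (1 + K/max{ln √x, 2}) √x`, `x = (a₁+a₂)(c₁+c₂)`, survives**
("the right hand sides increase if `a₁, a₂, c₁, c₂` increase … since `y = x/ln x` is
increasing": the right-hand side gains at least `2τ(1-θ)`, `le_logBarrier_sub`; the left-hand
side changes by at most `6θτ`). [cite: Hamilton1997, §4.3, pp. 57–58] -/
theorem improvedPinching (hm : 0 < m) (hK : 0 ≤ K)
    (h1 : p.1.TwoSmallestEigenvaluesSumGE m) (h2 : p.2.2.TwoSmallestEigenvaluesSumGE m)
    (h : ImprovedPinching p K) : ImprovedPinching q K := by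
  intro u v w w' z z' hu hv hw hw' hww hz hz' hzz
  have hp := h u v w w' z z' hu hv hw hw' hww hz hz' hzz
  set b := u ⬝ᵥ (p.2.1 *ᵥ v) with hbdef
  set X := w ⬝ᵥ (p.1 *ᵥ w) + w' ⬝ᵥ (p.1 *ᵥ w') with hXdef
  set Y := z ⬝ᵥ (p.2.2 *ᵥ z) + z' ⬝ᵥ (p.2.2 *ᵥ z') with hYdef
  have hX : 0 ≤ X := hm.le.trans (h1 w w' hw hw' hww)
  have hY : 0 ≤ Y := hm.le.trans (h2 z z' hz hz' hzz)
  have hs0 : 0 ≤ s := by linarith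
  set ξ := sqrt (X * Y) with hξ
  have hξ0 : 0 ≤ ξ := sqrt_nonneg _
  have hθτ8 : θ * τ ≤ 1 / 8 * τ := mul_le_mul_of_nonneg_right hθ8 hτ.le
  have hd0 : 0 ≤ 2 * τ * (1 - θ) := by linarith [hτ.le]
  -- the right-hand side: `√(X̃Ỹ) ≥ ξ + 2τ(1-θ)`
  have hXq : X + 2 * τ * (1 - θ) ≤ w ⬝ᵥ (q.1 *ᵥ w) + w' ⬝ᵥ (q.1 *ᵥ w') := by
    have h' := pairA_ge hA hw hw'
    have h'' := mul_nonneg (by linarith : (0:ℝ) ≤ s - 1) (add_nonneg hX hd0)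
    linarith
  have hYq : Y + 2 * τ * (1 - θ) ≤ z ⬝ᵥ (q.2.2 *ᵥ z) + z' ⬝ᵥ (q.2.2 *ᵥ z') := by
    have h' := pairC_ge hC hz hz'
    have h'' := mul_nonneg (by linarith : (0:ℝ) ≤ s - 1) (add_nonneg hY hd0)
    linarith
  set ξq := sqrt ((w ⬝ᵥ (q.1 *ᵥ w) + w' ⬝ᵥ (q.1 *ᵥ w')) *
    (z ⬝ᵥ (q.2.2 *ᵥ z) + z' ⬝ᵥ (q.2.2 *ᵥ z'))) with hξq
  have hξξq : ξ + 2 * τ * (1 - θ) ≤ ξq :=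
    (sqrt_mul_add_le_sqrt hX hY hd0).trans
      (sqrt_le_sqrt (mul_le_mul hXq hYq (by linarith) (hX.trans (by linarith))))
  have hmono := le_logBarrier_sub hK (le_refl (2:ℝ)) hξ0 (by linarith : ξ ≤ ξq)
  -- the left-hand side
  have hl := quadB_le hs hτ hκ0 hκ1 hθ0 hθ8 hρ₁ hρ hN hsN hB hu hv
  have hF0 : 0 ≤ (1 + K / max (log ξ) 2) * ξ := by
    have : 0 ≤ K / max (log ξ) 2 := div_nonneg hK (le_trans (by norm_num) (le_max_right _ _))
    positivity
  have hmax : 2 * max b 0 ≤ (1 + K / max (log ξ) 2) * ξ := by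
    rcases le_or_gt 0 b with hb | hb
    · rw [max_eq_left hb]; exact hp
    · rw [max_eq_right hb.le]; simpa using hF0
  have hθτ : 6 * θ * τ ≤ 2 * τ * (1 - θ) := by linarith
  linarith

include hs hτ hκ0 hκ1 hθ0 hθ8 hρ₁ hρ hN hsN hA hB hC in
/-- **The improved estimate `b₃ ≤ (1 + L e^{Pt}/max{ln √u², Q}) u`, `u² = (a₁+ρ)(c₁+ρ)`, survives
at time `t`** (`Pt` arbitrary, `L ≥ 0`, `Q ≥ 2`): the right-hand side gains at least `τ(1-2θ)`
(`le_logBarrier_sub`, `quadA_add_ge`), the left-hand side changes by at most `3θτ`.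
[cite: Hamilton1997, §4.3, p. 58] -/
theorem improvedPinchingQ (hL : 0 ≤ L) (hQ : 2 ≤ Q)
    (h6 : p.1.SmallestEigenvalueAddNonneg ρ₁) (h7 : p.2.2.SmallestEigenvalueAddNonneg ρ₁)
    (h : ImprovedPinchingQ p ρ L P Q t) : ImprovedPinchingQ q ρ L P Q t := by
  intro u v w w' hu hv hw hw'
  have hp := h u v w w' hu hv hw hw'
  set b := u ⬝ᵥ (p.2.1 *ᵥ v) with hbdef
  set Xw := w ⬝ᵥ (p.1 *ᵥ w) with hXw
  set Yw := w' ⬝ᵥ (p.2.2 *ᵥ w') with hYw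
  have hXρ : 0 ≤ Xw + ρ := by linarith [h6 w hw]
  have hYρ : 0 ≤ Yw + ρ := by linarith [h7 w' hw']
  set r := sqrt ((Xw + ρ) * (Yw + ρ)) with hr
  have hr0 : 0 ≤ r := sqrt_nonneg _
  have hθτ8 : θ * τ ≤ 1 / 8 * τ := mul_le_mul_of_nonneg_right hθ8 hτ.le
  have hd0 : 0 ≤ τ * (1 - 2 * θ) := by linarith [hτ.le]
  have hA' := quadA_add_ge hs hτ hθ8 hρ₁ hρ hN hsN hA h6 hw
  have hC' := quadC_add_ge hs hτ hθ8 hρ₁ hρ hN hsN hC h7 hw'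
  set rq := sqrt ((w ⬝ᵥ (q.1 *ᵥ w) + ρ) * (w' ⬝ᵥ (q.2.2 *ᵥ w') + ρ)) with hrq
  have hrrq : r + τ * (1 - 2 * θ) ≤ rq :=
    (sqrt_mul_add_le_sqrt hXρ hYρ hd0).trans
      (sqrt_le_sqrt (mul_le_mul hA' hC' (by linarith) (hXρ.trans (by linarith))))
  have hK' : 0 ≤ L * exp (P * t) := mul_nonneg hL (exp_pos _).le
  have hmono := le_logBarrier_sub hK' hQ hr0 (by linarith : r ≤ rq)
  have hl := quadB_le hs hτ hκ0 hκ1 hθ0 hθ8 hρ₁ hρ hN hsN hB hu hv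
  have hF0 : 0 ≤ (1 + L * exp (P * t) / max (log r) Q) * r := by
    have : 0 ≤ L * exp (P * t) / max (log r) Q :=
      div_nonneg hK' (le_trans (by linarith) (le_max_right _ _))
    positivity
  have hmax : max b 0 ≤ (1 + L * exp (P * t) / max (log r) Q) * r := by
    rcases le_or_gt 0 b with hb | hb
    · rw [max_eq_left hb]; exact hp
    · rw [max_eq_right hb.le]; exact hF0
  have hθτ : 3 * θ * τ ≤ τ * (1 - 2 * θ) := by linarith
  linarith

end Shift

/-! ### Assembly: Hamilton's family survives the change -/

/-- **Hamilton 1997, Thm. D3.1 (algebraic half): the complete system of pinching inequalities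
survives a change of the curvature blocks of the surgical shape.** Let
`p = (A, B, C) ∈ pinchingFamily m Λ Φ ρ₁ ρ Ψ K L P Q t` with `m > 0`, `Λ ≥ 1`, `Φ ≥ 2`,
`0 ≤ ρ₁ ≤ ρ`, `Ψ ≥ 2`, `K ≥ 0`, `L > 0`, `Q ≥ 2`, `Pt ≥ 0`, and let `q = (Ã, B̃, C̃)` have
symmetric `Ã, C̃` with `tr Ã = tr C̃`. If for a scale factor `s ≥ 1`, a shift `τ > 0`, a
contraction factor `κ ∈ [0, 1]`, a bound `N ≥ |uᵀBv|` (unit `u, v`) and an error parameter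
`0 ≤ θ ≤ min{1/8, L/16}` one has `|wᵀÃw - s(wᵀAw + τ)| ≤ sθτ`, `|wᵀC̃w - s(wᵀCw + τ)| ≤ sθτ`
(unit `w`), `|uᵀB̃v - sκ uᵀBv| ≤ sθτ` (unit `u, v`) and `(s - 1)(N + ρ + τ) ≤ θτ`, then
`q ∈ pinchingFamily m Λ Φ ρ₁ ρ Ψ K L P Q t`. In the surgery (Chen–Zhu 2006, Lemma 5.3) `p` are
the blocks of the limit metric `ḡ` at a point of the `δ`-neck, `q` those of
`g̃ = e^{-2f} ḡ` in the rescaled frame, `s = e^{2f}`, `τ` the `D₄D₄f`-shift of Thm. D2.6, and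
`θ → 0` as `δ → 0` (Lemmas D2.4, D2.5). [cite: Hamilton1997, §4.3, Thm. 3.1 (= D3.1), pp. 57–58]
[cite: ChenZhu2006, §5, Lemma 5.3 (p. 29)] -/
theorem mem_pinchingFamily_of_shift {m Λ Φ ρ₁ ρ Ψ K L P Q t : ℝ} {p q : Blocks}
    {s τ κ θ N : ℝ} (hm : 0 < m) (hΛ : 1 ≤ Λ) (hΦ : 2 ≤ Φ) (hρ₁ : 0 ≤ ρ₁) (hρ : ρ₁ ≤ ρ)
    (hΨ : 2 ≤ Ψ) (hK : 0 ≤ K) (hL : 0 < L) (hQ : 2 ≤ Q) (hPt : 0 ≤ P * t)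
    (hp : p ∈ pinchingFamily m Λ Φ ρ₁ ρ Ψ K L P Q t)
    (hqA : q.1.IsSymm) (hqC : q.2.2.IsSymm) (htr : q.1.trace = q.2.2.trace)
    (hs : 1 ≤ s) (hτ : 0 < τ) (hκ0 : 0 ≤ κ) (hκ1 : κ ≤ 1) (hθ0 : 0 ≤ θ) (hθ8 : θ ≤ 1 / 8)
    (hθL : θ ≤ L / 16)
    (hN : ∀ u v : Fin 3 → ℝ, u ⬝ᵥ u = 1 → v ⬝ᵥ v = 1 → |u ⬝ᵥ (p.2.1 *ᵥ v)| ≤ N)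
    (hsN : (s - 1) * (N + ρ + τ) ≤ θ * τ)
    (hA : ∀ w : Fin 3 → ℝ, w ⬝ᵥ w = 1 →
      |w ⬝ᵥ (q.1 *ᵥ w) - s * (w ⬝ᵥ (p.1 *ᵥ w) + τ)| ≤ s * θ * τ)
    (hB : ∀ u v : Fin 3 → ℝ, u ⬝ᵥ u = 1 → v ⬝ᵥ v = 1 →
      |u ⬝ᵥ (q.2.1 *ᵥ v) - s * κ * (u ⬝ᵥ (p.2.1 *ᵥ v))| ≤ s * θ * τ)
    (hC : ∀ w : Fin 3 → ℝ, w ⬝ᵥ w = 1 →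
      |w ⬝ᵥ (q.2.2 *ᵥ w) - s * (w ⬝ᵥ (p.2.2 *ᵥ w) + τ)| ≤ s * θ * τ) :
    q ∈ pinchingFamily m Λ Φ ρ₁ ρ Ψ K L P Q t := by
  obtain ⟨⟨⟨⟨⟨⟨⟨⟨⟨⟨⟨-, h1⟩, h2⟩, h3⟩, -⟩, h5⟩, h6⟩, h7⟩, h8⟩, h9⟩, h10⟩, h11⟩ := hp
  have h1' : p.1.TwoSmallestEigenvaluesSumGE m := h1
  have h2' : p.2.2.TwoSmallestEigenvaluesSumGE m := h2
  have h3' : SingularValuesSumSqLE p Λ := h3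
  have h6' : p.1.SmallestEigenvalueAddNonneg ρ₁ := h6
  have h7' : p.2.2.SmallestEigenvalueAddNonneg ρ₁ := h7
  have h9' : SingularValueLEExp p (L / 2) P ρ t := h9
  have h10' : ImprovedPinching p K := h10
  have h11' : ImprovedPinchingQ p ρ L P Q t := h11
  refine ⟨⟨⟨⟨⟨⟨⟨⟨⟨⟨⟨⟨hqA, hqC⟩, ?_⟩, ?_⟩, ?_⟩, htr⟩, ?_⟩, ?_⟩, ?_⟩, ?_⟩, ?_⟩, ?_⟩, ?_⟩
  · exact Shift.twoSmallest_fst hs hτ hθ8 hA hm h1'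
  · exact Shift.twoSmallest_snd hs hτ hθ8 hC hm h2'
  · exact Shift.singularValuesSumSqLE hs hτ hκ0 hκ1 hθ0 hθ8 hA hB hC hm hΛ h1' h2' h3'
  · exact ⟨Shift.twoLargest_fst hs hτ hθ8 hA hΦ h5.1, Shift.twoLargest_snd hs hτ hθ8 hC hΦ h5.2⟩
  · exact Shift.smallestAddNonneg_fst hs hτ hθ8 hρ₁ hρ hN hsN hA h6'
  · exact Shift.smallestAddNonneg_snd hs hτ hθ8 hρ₁ hρ hN hsN hC h7'
  · exact ⟨Shift.largestLESmallestAdd_fst hs hτ hθ0 hθ8 hρ₁ hρ hN hsN hA hΨ h8.1,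
      Shift.largestLESmallestAdd_snd hs hτ hθ0 hθ8 hρ₁ hρ hN hsN hC hΨ h8.2⟩
  · exact Shift.singularValueLEExp hs hτ hκ0 hκ1 hθ0 hθ8 hρ₁ hρ hN hsN hA hB hC hL hθL hPt
      h6' h7' h9'
  · exact Shift.improvedPinching hs hτ hκ0 hκ1 hθ0 hθ8 hρ₁ hρ hN hsN hA hB hC hm hK h1' h2' h10'
  · exact Shift.improvedPinchingQ hs hτ hκ0 hκ1 hθ0 hθ8 hρ₁ hρ hN hsN hA hB hC hL.le hQ h6' h7'
      h11'

/-- **The case of an exact shift without scaling** (`s = 1`, `κ = 1`, no errors): if `p` lies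
in the family then so does `(A + τ·1, B, C + τ·1)` for every `τ > 0` — "the `aᵢ` and `cᵢ`
increase by the same amount while the `bᵢ` stay" keeps every inequality (the model statement
behind Cor. D2.7). [cite: Hamilton1997, §4.3, p. 57] -/
theorem mem_pinchingFamily_add_smul_one {m Λ Φ ρ₁ ρ Ψ K L P Q t : ℝ} {p : Blocks} {τ : ℝ}
    (hm : 0 < m) (hΛ : 1 ≤ Λ) (hΦ : 2 ≤ Φ) (hρ₁ : 0 ≤ ρ₁) (hρ : ρ₁ ≤ ρ) (hΨ : 2 ≤ Ψ)
    (hK : 0 ≤ K) (hL : 0 < L) (hQ : 2 ≤ Q) (hPt : 0 ≤ P * t)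
    (hp : p ∈ pinchingFamily m Λ Φ ρ₁ ρ Ψ K L P Q t) (hτ : 0 < τ) :
    ((p.1 + τ • (1 : Matrix (Fin 3) (Fin 3) ℝ), p.2.1, p.2.2 + τ • (1 : Matrix (Fin 3) (Fin 3) ℝ))
      : Blocks) ∈ pinchingFamily m Λ Φ ρ₁ ρ Ψ K L P Q t := by
  have hsymm : p.1.IsSymm ∧ p.2.2.IsSymm := hp.1.1.1.1.1.1.1.1.1.1.1
  have htr : p.1.trace = p.2.2.trace := hp.1.1.1.1.1.1.1.2
  -- a bound for `B`
  obtain ⟨N, hN⟩ : ∃ N : ℝ, ∀ u v : Fin 3 → ℝ, u ⬝ᵥ u = 1 → v ⬝ᵥ v = 1 →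
      |u ⬝ᵥ (p.2.1 *ᵥ v)| ≤ N := by
    refine ⟨∑ i, ∑ j, |p.2.1 i j|, fun u v hu hv ↦ ?_⟩
    have habs : ∀ x : Fin 3 → ℝ, x ⬝ᵥ x = 1 → ∀ i, |x i| ≤ 1 := by
      intro x hx i
      have hsum : x i ^ 2 ≤ x ⬝ᵥ x := by
        simp only [dotProduct, Fin.sum_univ_three]
        fin_cases i <;> simp <;> nlinarith [sq_nonneg (x 0), sq_nonneg (x 1), sq_nonneg (x 2)]
      rw [hx] at hsum
      exact abs_le_one_iff_mul_self_le_one.mpr (by nlinarith)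
    have hu1 : ∀ i, |u i| ≤ 1 := habs u hu
    have hv1 : ∀ j, |v j| ≤ 1 := habs v hv
    simp only [dotProduct, Matrix.mulVec, Finset.mul_sum]
    refine (Finset.abs_sum_le_sum_abs _ _).trans (Finset.sum_le_sum fun i _ ↦ ?_)
    refine (Finset.abs_sum_le_sum_abs _ _).trans (Finset.sum_le_sum fun j _ ↦ ?_)
    rw [abs_mul, abs_mul]
    calc |u i| * (|p.2.1 i j| * |v j|) ≤ 1 * (|p.2.1 i j| * 1) := by
          gcongr
          · exact hu1 i
          · exact hv1 j
      _ = |p.2.1 i j| := by ring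
  have quad_one : ∀ w : Fin 3 → ℝ, w ⬝ᵥ w = 1 → ∀ X : Matrix (Fin 3) (Fin 3) ℝ,
      w ⬝ᵥ ((X + τ • (1 : Matrix (Fin 3) (Fin 3) ℝ)) *ᵥ w) = w ⬝ᵥ (X *ᵥ w) + τ := by
    intro w hw X
    rw [Matrix.add_mulVec, dotProduct_add, Matrix.smul_mulVec, Matrix.one_mulVec,
      dotProduct_smul, hw, smul_eq_mul, mul_one]
  refine mem_pinchingFamily_of_shift (s := 1) (κ := 1) (θ := 0) (N := N) hm hΛ hΦ hρ₁ hρ hΨ hK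
    hL hQ hPt hp ?_ ?_ ?_ le_rfl hτ zero_le_one le_rfl le_rfl (by norm_num) (by positivity) hN
    (by simp) ?_ ?_ ?_
  · exact hsymm.1.add (Matrix.isSymm_one.smul τ)
  · exact hsymm.2.add (Matrix.isSymm_one.smul τ)
  · simp only [Matrix.trace_add, Matrix.trace_smul, htr]
  · intro w hw; simp [quad_one w hw]
  · intro u v hu hv; simp
  · intro w hw; simp [quad_one w hw]

end HamiltonODE

end Literature.Geometry.Riemannian

end
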